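import Summits.Langlands.Langlands.Statement
import Literature.NumberTheory.Automorphic.CarayolCompatibilityOfLocalGlobalProofs
import Literature.NumberTheory.Automorphic.LocalComponentBJGenericProofs
import Literature.NumberTheory.Automorphic.LocalComponentBJSatakeProofs
import Literature.NumberTheory.GaloisRepresentations.WeilDeligneRepFrobSemisimpleProofs
import Literature.NumberTheory.GaloisRepresentations.WeilDeligneRepProofs
import HarnessLib

/-!
# Line `Sketch` for the crux `ReciprocityUpToIrreducibility` (item stmt-Langlands-14328), continuation c5:
# stub H3 — the automorphic side of the rank-two unramified matching

Support file (closes nothing; registered stub `stub_recGL_two_unramified` of the checked skeleton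
`Lines/Sketch.lean`, wave N4 of continuation lead c5).

For a cuspidal `π` on `GL₂(𝔸_K)` with Satake parameter `α` at `v`, a local component `π_v` of `π`
at `v` and ANY local Langlands datum `L` of `K_v`, every Frobenius-semisimple representative `A` of
`L.recGL 2 ⟦π_v⟧` has `N = 0`, is trivial on inertia, and `char(A.ρ Φ) = ∏_{a ∈ α} (X - a)` for
every geometric Frobenius `Φ` (`deg Φ = -1`).  The work is the tree's local deduction
`WeilDeligneRep.unramified_of_hasFrobSemisimpleClass_recGL_of_isSatakeParameter`
(`CarayolCompatibilityOfLocalGlobalProofs`: clause (iii-L) of the datum + the spherical zeta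
integral of `GL₂ × GL₁`), fed by the genericity of cuspidal local components
(`CuspidalAutomorphicRepData.exists_isGeneric_of_hasLocalComponentAt`) and the Satake dictionary
(`CuspidalAutomorphicRepData.isSatakeParameter_of_hasLocalComponentAt`); here we only move from
the chosen geometric Frobenius to all of them (two geometric Frobenii differ by inertia) and from
`det(1 - TΦ) = 1 - e₁ T + e₂ T²` to `det(X - Φ) = X² - e₁ X + e₂ = ∏ (X - a)`.  No definitions;
std axioms.
-/

noncomputable section

set_option linter.dupNamespace false -- project-wide option (lakefile weak.linter.dupNamespace); `Summit.Langlands.Langlands` is the mandated namespace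

open scoped MatrixGroups Matrix NumberField Classical Polynomial
open Filter IsDedekindDomain Field Polynomial
open Literature.NumberTheory.Automorphic Literature.NumberTheory.GaloisRepresentations
open Literature.NumberTheory.PAdicHodge
open Summit.Langlands

namespace Summit.Langlands.Langlands.Theorems.ReciprocityUpToIrreducibility

/-- A `2 × 2` matrix with `det(1 - T M) = 1 - e₁ T + e₂ T²` has `det(X - M) = X² - e₁ X + e₂`
(`det(1 - T M) = 1 - tr(M) T + det(M) T²`, tree lemma `DeligneSerre1974.TwoByTwo.charpolyRev_fin_two`;
`det(X - M) = X² - tr(M) X + det(M)`, Mathlib `Matrix.charpoly_fin_two`). [folklore] -/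
theorem charpoly_fin_two_of_charpolyRev_recGLTwoUnramified {R : Type*} [CommRing R] [Nontrivial R]
    (M : Matrix (Fin 2) (Fin 2) R) {e₁ e₂ : R}
    (h : M.charpolyRev = 1 - C e₁ * X + C e₂ * X ^ 2) :
    M.charpoly = X ^ 2 - C e₁ * X + C e₂ := by
  rw [DeligneSerre1974.TwoByTwo.charpolyRev_fin_two] at h
  have h1 := congrArg (fun p : R[X] => p.coeff 1) h
  have h2 := congrArg (fun p : R[X] => p.coeff 2) h
  simp [Polynomial.coeff_one, Polynomial.coeff_X_pow, Polynomial.coeff_C_mul] at h1 h2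
  rw [Matrix.charpoly_fin_two, h1, h2]

/-- Two geometric Frobenii act alike in an unramified representation of `W_F`: if `deg w = deg w'`
and `ρ` is trivial on inertia then `ρ w = ρ w'` (`w w'⁻¹ ∈ I_F`). [cite: TateCorvallis1979, (1.4.1), (4.1.6)] -/
theorem isUnramifiedRep_apply_eq_of_deg_eq_recGLTwoUnramified
    {F : Type} [Field F] [ValuativeRel F] [TopologicalSpace F] [IsNonarchimedeanLocalField F]
    {V : Type*} [AddCommGroup V] [Module ℂ V] {ρ : Representation ℂ (WeilGroup F) V}
    (hρ : WeilGroup.IsUnramifiedRep ρ) {w w' : WeilGroup F} (h : WeilGroup.deg w = WeilGroup.deg w') :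
    ρ w = ρ w' := by
  have hmem := WeilGroup.mul_inv_mem_inertia_of_deg_eq h
  calc ρ w = ρ ((w * w'⁻¹) * w') := by rw [inv_mul_cancel_right]
    _ = ρ w' := by rw [map_mul, hρ _ hmem, one_mul]

/-- **Stub H3 (automorphic side, `GL₂`, unconditional).**  For a cuspidal `π` on `GL₂(𝔸_K)` with
Satake parameter `α` at `v`, a local component `π_v` of `π` at `v` and ANY local Langlands datum `L`
of `K_v`: every Frobenius-semisimple representative `A` of `L.recGL 2 ⟦π_v⟧` has `N = 0`, is trivial on
inertia, and `char(A.ρ Φ) = ∏_{a ∈ α} (X - a)` for every geometric Frobenius `Φ`.  In the tree for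
`rℂ := A` and the chosen `geomFrob`: `WeilDeligneRep.unramified_of_hasFrobSemisimpleClass_recGL_of_isSatakeParameter`
(clause (iii-L) `lFactor_pairs` of `L` + the spherical zeta integral of `GL₂ × GL₁`), fed by the
genericity of cuspidal local components (`CuspidalAutomorphicRepData.exists_isGeneric_of_hasLocalComponentAt`)
and the Satake dictionary (`CuspidalAutomorphicRepData.isSatakeParameter_of_hasLocalComponentAt`,
`card α = 2`); any two geometric Frobenii differ by inertia; `charpolyRev ↔ charpoly` for `2 × 2`
matrices. [cite: JacquetLanglands1970, Prop. 3.5] [cite: HarrisTaylorAMS2001, Thm. A (ii), (v)]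
[cite: TateCorvallis1979, (4.1.6)] -/
theorem stub_recGL_two_unramified :
    ∀ (K : Type) [Field K] [NumberField K] (hcpt : isCompact_glFiniteIntegralLevel 2 K)
      (π : CuspidalAutomorphicRepData 2 K hcpt) (v : HeightOneSpectrum (𝓞 K)) (α : Multiset ℂ),
      π.1.HasSatakeParamAt v α →
      ∀ (L : LocalLanglandsDatum (v.adicCompletion K))
        (πv : SmoothIrrep (GL (Fin 2) (v.adicCompletion K))), π.1.HasLocalComponentAt v πv.ρ →
        ∀ (A : WeilDeligneRep (v.adicCompletion K) ℂ (Fin 2 → ℂ)) (hA : A.IsFrobSemisimple),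
          L.recGL 2 (IrrClass.mk πv) =
            Quotient.mk (frobSemisimpleWDSetoid (v.adicCompletion K) 2) ⟨A, hA⟩ →
          A.N = 0 ∧ WeilGroup.IsUnramifiedRep A.ρ ∧
            ∀ Φ : WeilGroup (v.adicCompletion K), WeilGroup.deg Φ = -1 →
              (A.ρ Φ).charpoly = (α.map fun a => X - C a).prod := by
  intro K _ _ hcpt π v α hα L πv hloc A hA hcl
  classical
  haveI := πv.isIrreducible
  -- `π_v` is generic and has the Satake parameter `α = {x₀, x₁}`
  obtain ⟨ψ, hψ, hgen⟩ := π.exists_isGeneric_of_hasLocalComponentAt v πv.ρ πv.isSmooth hloc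
  obtain ⟨ϖ, hϖ⟩ := Valuation.exists_isUniformizer_of_isCyclic_of_nontrivial
    (ValuativeRel.valuation (v.adicCompletion K))
  set ϖu : (v.adicCompletion K)ˣ := Units.mk0 (ϖ : v.adicCompletion K) hϖ.ne_zero
  have hϖu' : IsUniformizingElement ((ϖu : (v.adicCompletion K)ˣ) : v.adicCompletion K) :=
    isUniformizingElement_of_isUniformizer hϖ
  have hsat := π.isSatakeParameter_of_hasLocalComponentAt v πv.ρ πv.isSmooth hloc hα (ϖ' := ϖu) hϖ
  obtain ⟨x, hx⟩ := exists_univ_val_map_eq (R := ℂ) hsat.1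
  subst hx
  -- the local deduction for `rℂ := A`, which represents its own class
  have hcl' : A.HasFrobSemisimpleClass (L.recGL 2 (IrrClass.mk πv)) := by
    rw [hcl]
    exact hA.hasFrobSemisimpleClass
  obtain ⟨-, hN, hur, hch⟩ :=
    WeilDeligneRep.unramified_of_hasFrobSemisimpleClass_recGL_of_isSatakeParameter L πv hψ hgen
      hϖu' hsat hcl'
  refine ⟨hN, hur, fun Φ hΦ => ?_⟩
  -- any geometric Frobenius acts as the chosen one
  have hΦeq : A.ρ Φ = A.ρ (WeilDeligneRep.geomFrob (v.adicCompletion K) L.hex) :=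
    isUnramifiedRep_apply_eq_of_deg_eq_recGLTwoUnramified hur
      (by rw [hΦ, WeilDeligneRep.deg_geomFrob' L.hex])
  rw [hΦeq, charpoly_eq_charpoly_toMatrix',
    charpoly_fin_two_of_charpolyRev_recGLTwoUnramified _ hch, esymm_fin_two_one, esymm_fin_two_two,
    Multiset.map_map, Finset.prod_map_val, Fin.prod_univ_two]
  simp only [Function.comp_apply, map_add, map_mul]
  ring

end Summit.Langlands.Langlands.Theorems.ReciprocityUpToIrreducibility

end
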